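import Mathlib.Tactic
import HarnessLib
import HarnessLib.Audit.Tags
import Summits.CriticalPhenomena.PercolationContinuityZ3.Theorems.PercNearOneGluingNoHeavyLowerTailSahiRainbowIsolated

/-!
# The rainbow lemma reduced to an absorption-robust count for antichains

Support file (seat `prim-masterthm-p1`, gen 38; `--supports stmt-CriticalPhenomena-4575`).  One typed statement (`def … : Prop`), no `sorry`,
standard axioms.  Memo `run/shared/lean/prim/prim-masterthm/FROM-prim-masterthm-p1-g38-BLOWUP-SIDE.md` §6.

SETTING (`…SahiPartitionDaykin`, `…SahiRainbowIsolated`): `P ⊆ 2^F` complement-free; `rainbowMeets F P = {∅} ∪ {a ∩ b} ∪ {F \ (a ∪ b)}` (distinct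
members); RAINBOW (`RainbowMeetCojoin`, OPEN): `#P ≤ #rainbowMeets F P`.  Kernel: comparable members pay for themselves, so RAINBOW ⟸ `IsolatedRainbow`:
the isolated members `I` (an antichain) are paid by rainbow meets outside `C ∪ σC` (`C` = comparable members); and the rainbow lemma for complement-free
ANTICHAINS is a theorem (`card_le_card_rainbowMeets_of_antichain`, gen 38, via V5).

NEW HERE ([this work], gen 38).  The colours of the antichain `I` that can be ABSORBED into `C ∪ σC` are exactly: a meet `x = i ∩ i'` whose complement
`F \ x` is a member `c ∈ C` (necessarily incomparable with every isolated member), or a complemented join `x = F \ (i ∪ i')` that is itself a member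
`c ∈ C`; in both cases the member `c` returns the two differences `i \ i' = c ∩ i` resp. `= F \ (c ∪ i')` and `i' \ i` as rainbow meets of `P`, and these
never lie in `C ∪ σC`.  Hence:
* `AntichainAbsorptionRainbow` (typed, [status: open]): for a complement-free antichain `I` (`#I ≥ 2`) and any sets `Sm` of such meets / `Sj` of such
  complemented joins (absorbers incomparable with `I`), `#I ≤ #((rainbowMeets F I \ (Sm ∪ σSm ∪ Sj ∪ σSj)) ∪ {i \ i' : i ∩ i' ∈ Sm ∨ F \ (i ∪ i') ∈ Sj})`.
  EVIDENCE: true for EVERY complement-free antichain of `2^n`, `n ≤ 6` (3 200 940 antichains of `2^6`), and every choice of `Sm, Sj` (≤ 12 absorbable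
  colours; engines `prim-masterthm-p1/code-g38/c/zstar2.c`, `zstar4.c`); slack ≥ 1 when all absorbable colours are absorbed (`zstar.c`, `n ≤ 5`).
* `isolatedRainbow_of_antichainAbsorptionRainbow`: **`AntichainAbsorptionRainbow ⟹ IsolatedRainbow`**, hence (`rainbowMeetCojoin_of_antichainAbsorptionRainbow`)
  **⟹ `RainbowMeetCojoin`** — the rainbow lemma for general complement-free families is reduced to a statement about antichains alone.
HONEST FRAMING: `AntichainAbsorptionRainbow`, `IsolatedRainbow`, `RainbowMeetCojoin` remain OPEN; the reductions are unconditional. [this work]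
-/

namespace Summit.CriticalPhenomena.PercolationContinuityZ3.Theorems.SahiColouredDaykin

open Finset

variable {α : Type*} [DecidableEq α]

/-- **CONJECTURE (absorption-robust rainbow count for antichains; typed).**  For a complement-free antichain `I ⊆ 2^F` with at least two members,
a set `Sm` of pairwise meets whose complements are incomparable with every member, and a set `Sj` of complemented pairwise joins incomparable with
every member: removing `Sm ∪ σSm ∪ Sj ∪ σSj` from the rainbow meets of `I` and adding the differences `i \ i'` of the pairs with `i ∩ i' ∈ Sm` or
`F \ (i ∪ i') ∈ Sj` leaves at least `#I` sets.  Exhaustively true on `2^n`, `n ≤ 6`, for all `Sm, Sj` (file header); implies `IsolatedRainbow` and the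
rainbow lemma (`isolatedRainbow_of_antichainAbsorptionRainbow`). [this work] [status: open] -/
@[conjecture] def AntichainAbsorptionRainbow (α : Type*) [DecidableEq α] : Prop :=
  ∀ (F : Finset α) (I Sm Sj : Finset (Finset α)),
    (∀ i ∈ I, i ⊆ F) → (∀ i ∈ I, F \ i ∉ I) → IsAntichain (· ⊆ ·) (I : Set (Finset α)) → 2 ≤ #I →
    (∀ x ∈ Sm, (∃ i ∈ I, ∃ i' ∈ I, i ≠ i' ∧ x = i ∩ i') ∧ ∀ i ∈ I, ¬ F \ x ⊆ i ∧ ¬ i ⊆ F \ x) →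
    (∀ x ∈ Sj, (∃ i ∈ I, ∃ i' ∈ I, i ≠ i' ∧ x = F \ (i ∪ i')) ∧ ∀ i ∈ I, ¬ x ⊆ i ∧ ¬ i ⊆ x) →
    #I ≤ #((rainbowMeets F I \ (Sm ∪ Sm.image (F \ ·) ∪ Sj ∪ Sj.image (F \ ·))) ∪
      ((I.offDiag.filter fun p => p.1 ∩ p.2 ∈ Sm ∨ F \ (p.1 ∪ p.2) ∈ Sj).image fun p => p.1 \ p.2))

/-! ### The reduction -/

section Reduction

variable {F : Finset α} {P : Finset (Finset α)}

/-- An isolated member is incomparable with every other member. [this work] -/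
theorem not_subset_of_mem_isoMembers {i b : Finset α} (hi : i ∈ isoMembers P) (hb : b ∈ P) (hne : b ≠ i) : ¬ i ⊆ b ∧ ¬ b ⊆ i := by
  have h := (mem_isoMembers_iff.1 hi).2 b hb hne
  exact ⟨fun h' => h (Or.inl h'), fun h' => h (Or.inr h')⟩

/-- Comparable and isolated members are different members. [this work] -/
theorem ne_of_mem_compMembers_of_mem_isoMembers {c i : Finset α} (hc : c ∈ compMembers P) (hi : i ∈ isoMembers P) : c ≠ i := by
  rintro rfl
  obtain ⟨_, b, hb, hbc, hcomp⟩ := mem_compMembers_iff.1 hc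
  exact (mem_isoMembers_iff.1 hi).2 b hb hbc hcomp

/-- Rainbow meets are monotone in the family. [this work] -/
theorem rainbowMeets_mono (F : Finset α) {Q P : Finset (Finset α)} (h : Q ⊆ P) : rainbowMeets F Q ⊆ rainbowMeets F P := by
  intro Z hZ
  rcases mem_rainbowMeets_iff.1 hZ with rfl | ⟨a, ha, b, hb, hab, hZ⟩
  · exact mem_rainbowMeets_iff.2 (Or.inl rfl)
  · exact mem_rainbowMeets_iff.2 (Or.inr ⟨a, h ha, b, h hb, hab, hZ⟩)

/-- With at least two isolated members, neither `∅` nor `F` is a comparable member. [this work] -/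
theorem empty_top_not_mem_compMembers (hPF : ∀ S ∈ P, S ⊆ F) (h2 : 2 ≤ #(isoMembers P)) :
    (∅ : Finset α) ∉ compMembers P ∧ F ∉ compMembers P := by
  constructor
  · intro h0
    obtain ⟨i, hi, hne⟩ := exists_mem_ne (by omega : 1 < #(isoMembers P)) (∅ : Finset α)
    exact (not_subset_of_mem_isoMembers hi (compMembers_subset P h0) hne.symm).2 (empty_subset _)
  · intro hF
    obtain ⟨i, hi, hne⟩ := exists_mem_ne (by omega : 1 < #(isoMembers P)) F
    exact (not_subset_of_mem_isoMembers hi (compMembers_subset P hF) hne.symm).1 (hPF i (isoMembers_subset P hi))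

/-- **`AntichainAbsorptionRainbow ⟹ IsolatedRainbow`.** [this work] -/
theorem isolatedRainbow_of_antichainAbsorptionRainbow (h : AntichainAbsorptionRainbow α) : IsolatedRainbow α := by
  intro F P hPF hcf
  set I := isoMembers P with hIdef
  set C := compMembers P with hCdef
  have hIP : I ⊆ P := isoMembers_subset P
  have hCP : C ⊆ P := compMembers_subset P
  by_cases h2 : 2 ≤ #I
  swap
  · -- at most one isolated member: `∅` pays for it
    by_cases h0 : #I = 0
    · rw [h0]; exact Nat.zero_le _
    have h1 : #I = 1 := by omega
    obtain ⟨i, hI⟩ := card_eq_one.1 h1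
    have hi : i ∈ I := by rw [hI]; exact mem_singleton_self i
    rw [h1]
    apply card_pos.2
    refine ⟨∅, mem_sdiff.2 ⟨mem_rainbowMeets_iff.2 (Or.inl rfl), fun hmem => ?_⟩⟩
    rcases mem_union.1 hmem with h0C | hFC
    · by_cases hie : i = ∅
      · -- `i = ∅` isolated and `∅` comparable: impossible (they would be the same member)
        exact ne_of_mem_compMembers_of_mem_isoMembers h0C hi hie.symm
      · exact (not_subset_of_mem_isoMembers hi (hCP h0C) (Ne.symm hie)).2 (empty_subset _)
    · obtain ⟨c, hc, hcF⟩ := mem_image.1 hFC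
      have hcF' : c = F := by
        have := Finset.sdiff_sdiff_eq_self (hPF c (hCP hc)); rw [hcF, sdiff_empty] at this; exact this.symm
      rw [hcF'] at hc
      by_cases hiF : i = F
      · exact ne_of_mem_compMembers_of_mem_isoMembers hc hi hiF.symm
      · exact (not_subset_of_mem_isoMembers hi (hCP hc) (Ne.symm hiF)).1 (hPF i (hIP hi))
  -- the absorbed colours
  set Sm := (I.offDiag.image fun p => p.1 ∩ p.2).filter (fun x => F \ x ∈ C) with hSm
  set Sj := (I.offDiag.image fun p => F \ (p.1 ∪ p.2)).filter (fun x => x ∈ C) with hSj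
  have incomp : ∀ {c i : Finset α}, c ∈ C → i ∈ I → ¬ c ⊆ i ∧ ¬ i ⊆ c := by
    intro c i hc hi
    have := not_subset_of_mem_isoMembers hi (hCP hc) (ne_of_mem_compMembers_of_mem_isoMembers hc hi)
    exact ⟨this.2, this.1⟩
  have hSm' : ∀ x ∈ Sm, (∃ i ∈ I, ∃ i' ∈ I, i ≠ i' ∧ x = i ∩ i') ∧ ∀ i ∈ I, ¬ F \ x ⊆ i ∧ ¬ i ⊆ F \ x := by
    intro x hx
    obtain ⟨hx, hxc⟩ := mem_filter.1 hx
    obtain ⟨⟨i, i'⟩, hp, rfl⟩ := mem_image.1 hx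
    obtain ⟨hi, hi', hne⟩ := mem_offDiag.1 hp
    exact ⟨⟨i, hi, i', hi', hne, rfl⟩, fun j hj => incomp hxc hj⟩
  have hSj' : ∀ x ∈ Sj, (∃ i ∈ I, ∃ i' ∈ I, i ≠ i' ∧ x = F \ (i ∪ i')) ∧ ∀ i ∈ I, ¬ x ⊆ i ∧ ¬ i ⊆ x := by
    intro x hx
    obtain ⟨hx, hxc⟩ := mem_filter.1 hx
    obtain ⟨⟨i, i'⟩, hp, rfl⟩ := mem_image.1 hx
    obtain ⟨hi, hi', hne⟩ := mem_offDiag.1 hp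
    exact ⟨⟨i, hi, i', hi', hne, rfl⟩, fun j hj => incomp hxc hj⟩
  have hantiI : IsAntichain (· ⊆ ·) (I : Set (Finset α)) := by
    intro a ha b hb hab hab'
    exact (not_subset_of_mem_isoMembers (mem_coe.1 ha) (hIP (mem_coe.1 hb)) (Ne.symm hab)).1 hab'
  have key := h F I Sm Sj (fun i hi => hPF i (hIP hi)) (fun i hi hc => hcf i (hIP hi) (hIP hc))
    hantiI h2 hSm' hSj'
  refine key.trans (card_le_card ?_)
  obtain ⟨h0C, hFC⟩ := empty_top_not_mem_compMembers hPF (by rw [← hIdef]; exact h2)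
  -- every counted colour is a rainbow meet of `P` outside `C ∪ σC`
  have notC_of_subset : ∀ {Z i : Finset α}, i ∈ I → Z ⊆ i → Z ∉ C := by
    intro Z i hi hZi hZC
    by_cases hZeq : Z = i
    · exact ne_of_mem_compMembers_of_mem_isoMembers hZC hi hZeq
    · exact (incomp hZC hi).1 hZi
  have notσC_of_supset : ∀ {W i : Finset α}, i ∈ I → i ⊆ W → W ⊆ F → F \ W ∉ C.image (F \ ·) := by
    intro W i hi hiW hWF hmem
    obtain ⟨c, hc, hcW⟩ := mem_image.1 hmem
    have hcW' : c = W := by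
      rw [← Finset.sdiff_sdiff_eq_self (hPF c (hCP hc)), hcW, Finset.sdiff_sdiff_eq_self hWF]
    rw [hcW'] at hc
    by_cases hci : W = i
    · exact ne_of_mem_compMembers_of_mem_isoMembers hc hi hci
    · exact (incomp hc hi).2 hiW
  intro Z hZ
  rw [mem_sdiff]
  rcases mem_union.1 hZ with hZ | hZ
  · -- an unabsorbed colour of the antichain
    obtain ⟨hZI, hZS⟩ := mem_sdiff.1 hZ
    simp only [mem_union, not_or] at hZS
    obtain ⟨⟨⟨hZSm, hZσSm⟩, hZSj⟩, hZσSj⟩ := hZS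
    refine ⟨rainbowMeets_mono F hIP hZI, fun hmem => ?_⟩
    rcases mem_rainbowMeets_iff.1 hZI with rfl | ⟨i, hi, i', hi', hii', hZ'⟩
    · rcases mem_union.1 hmem with h | h
      · exact h0C h
      · obtain ⟨c, hc, hc0⟩ := mem_image.1 h
        have : c = F := by
          have := Finset.sdiff_sdiff_eq_self (hPF c (hCP hc)); rw [hc0, sdiff_empty] at this; exact this.symm
        exact hFC (this ▸ hc)
    · rcases hZ' with rfl | rfl
      · rcases mem_union.1 hmem with h | h
        · exact notC_of_subset hi inter_subset_left h
        · -- `i ∩ i' = F \ c` with `c ∈ C`: then it lies in `Sm`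
          obtain ⟨c, hc, hcZ⟩ := mem_image.1 h
          apply hZSm
          refine mem_filter.2 ⟨mem_image.2 ⟨(i, i'), mem_offDiag.2 ⟨hi, hi', hii'⟩, rfl⟩, ?_⟩
          have : F \ (i ∩ i') = c := by rw [← hcZ, Finset.sdiff_sdiff_eq_self (hPF c (hCP hc))]
          rw [this]; exact hc
      · rcases mem_union.1 hmem with h | h
        · exact hZSj (mem_filter.2 ⟨mem_image.2 ⟨(i, i'), mem_offDiag.2 ⟨hi, hi', hii'⟩, rfl⟩, h⟩)
        · exact notσC_of_supset hi subset_union_left (union_subset (hPF i (hIP hi)) (hPF i' (hIP hi'))) h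
  · -- a returned difference `i \ i'`
    obtain ⟨⟨i, i'⟩, hp, rfl⟩ := mem_image.1 hZ
    obtain ⟨hp, habs⟩ := mem_filter.1 hp
    obtain ⟨hi, hi', hii'⟩ := mem_offDiag.1 hp
    have hiF := hPF i (hIP hi)
    have hi'F := hPF i' (hIP hi')
    refine ⟨?_, fun hmem => ?_⟩
    · rcases habs with hm | hj
      · -- `c = F \ (i ∩ i') ∈ C` and `i \ i' = i ∩ c`
        have hc := (mem_filter.1 hm).2
        have e : i \ i' = i ∩ (F \ (i ∩ i')) := by
          ext x
          rw [mem_sdiff, mem_inter, mem_sdiff, mem_inter]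
          constructor
          · rintro ⟨hx, hx'⟩; exact ⟨hx, hiF hx, fun h => hx' h.2⟩
          · rintro ⟨hx, _, hx'⟩; exact ⟨hx, fun h => hx' ⟨hx, h⟩⟩
        rw [e]
        exact inter_mem_rainbowMeets (hIP hi) (hCP hc) (ne_of_mem_compMembers_of_mem_isoMembers hc hi).symm
      · -- `c = F \ (i ∪ i') ∈ C` and `i \ i' = F \ (i' ∪ c)`
        have hc := (mem_filter.1 hj).2
        have e : i \ i' = F \ (i' ∪ (F \ (i ∪ i'))) := by
          ext x
          rw [mem_sdiff, mem_sdiff, mem_union, mem_sdiff, mem_union]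
          constructor
          · rintro ⟨hx, hx'⟩
            exact ⟨hiF hx, fun h => h.elim hx' fun h' => h'.2 (Or.inl hx)⟩
          · rintro ⟨hxF, hx⟩
            have hx' : x ∉ i' := fun h => hx (Or.inl h)
            have hor : x ∈ i ∨ x ∈ i' := by by_contra hn; exact hx (Or.inr ⟨hxF, hn⟩)
            rcases hor with h | h
            · exact ⟨h, hx'⟩
            · exact absurd h hx'
        rw [e]
        exact sdiff_union_mem_rainbowMeets (hIP hi') (hCP hc) (ne_of_mem_compMembers_of_mem_isoMembers hc hi').symm
    · rcases mem_union.1 hmem with h | h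
      · exact notC_of_subset hi sdiff_subset h
      · -- `i \ i' = F \ c` forces `c ⊇ i'`
        obtain ⟨c, hc, hcZ⟩ := mem_image.1 h
        have hsub : i' ⊆ c := by
          intro x hx
          by_contra hxc
          have : x ∈ F \ c := mem_sdiff.2 ⟨hi'F hx, hxc⟩
          rw [hcZ] at this
          exact (mem_sdiff.1 this).2 hx
        by_cases hci : c = i'
        · exact ne_of_mem_compMembers_of_mem_isoMembers hc hi' hci
        · exact (incomp hc hi').2 hsub

/-- **`AntichainAbsorptionRainbow ⟹ RainbowMeetCojoin`** (the rainbow lemma). [this work] -/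
theorem rainbowMeetCojoin_of_antichainAbsorptionRainbow (h : AntichainAbsorptionRainbow α) : RainbowMeetCojoin α :=
  rainbowMeetCojoin_of_isolatedRainbow (isolatedRainbow_of_antichainAbsorptionRainbow h)

end Reduction

end Summit.CriticalPhenomena.PercolationContinuityZ3.Theorems.SahiColouredDaykin
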